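import Literature.Analysis.FluidPDE.TypeIAncientMild
import Literature.Analysis.FluidPDE.SelfSimilar
import HarnessLib

/-!
# Crux `PolyhedralDssProfileExists` (stmt-NavierStokesRegularity-1404), line `polyhedral_cell` —
# stub `stub_transport_ae` (exact DSS and `G`-equivariance pass to the continuous representative)

Let `u : ℝ → ℝ³ → ℝ³` be exactly `c`-DSS (`nsRescale c u = u`, `1 < c`) and `G`-equivariant at
every time (`u t (g x) = g (u t x)`, `g ∈ G ≤ O(3)`), and let `V` be an Oseen-gauge field
(`IsTypeIAncientMild C V`, so every negative slice `V t` is continuous) with `V t = u t` a.e. for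
every `t < 0` and `V t = 0` for `t ≥ 0`. Then `V` is exactly `c`-DSS and `G`-equivariant.

Proof. Fix `t < 0`. The dilation `x ↦ c • x` (`c ≠ 0`) and the isometries `g` preserve
Lebesgue-null sets (`Measure.quasiMeasurePreserving_smul`, `LinearIsometryEquiv.measurePreserving`),
so `x ↦ c • V (c²t) (c • x) = c • u (c²t) (c • x) = u t x = V t x` a.e. (and likewise
`V t ∘ g = u t ∘ g = g ∘ u t = g ∘ V t` a.e.); both extreme sides are continuous, hence equal
everywhere (`Continuous.ae_eq_iff_eq`: Lebesgue measure charges open sets). For `t ≥ 0` both sides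
vanish (`c² t ≥ 0`, `g 0 = 0`).
-/

noncomputable section

open MeasureTheory Set Function Filter Topology
open Literature.Analysis.FluidPDE

set_option linter.dupNamespace false

namespace Summit.NavierStokesRegularity.NavierStokesRegularity.Theorems.PolyhedralDssProfileExists.PolyhedralCell

/-- **Stub A2 (M): exact self-similarity and equivariance pass to the continuous representative.** If `u`
is exactly `c`-DSS (`nsRescale c u = u`) and `G`-equivariant at every time, and `V` is an Oseen-gauge field
(`IsTypeIAncientMild C V`, so its negative slices are continuous) with `V t = u t` a.e. for every `t < 0`
and `V t = 0` for `t ≥ 0`, then `V` is exactly `c`-DSS and `G`-equivariant at every time: on a negative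
slice both `x ↦ c • V (c²t) (c • x)` and `V t` (resp. `V t ∘ g` and `g ∘ V t`) are continuous and agree a.e.
— the linear automorphisms `x ↦ c • x` (`c ≠ 0`) and the isometries `g` preserve Lebesgue-null sets
(`Measure.quasiMeasurePreserving_smul` / `LinearIsometryEquiv.measurePreserving`) — hence agree
everywhere (`Continuous.ae_eq_iff_eq`); on `t ≥ 0` both sides vanish (`c² t ≥ 0`, `g 0 = 0`).
[cite: ChaeWolf2017RemovingDSS, Def. 1.1] -/
theorem stub_transport_ae :
    ∀ (G : Subgroup (EuclideanSpace ℝ (Fin 3) ≃ₗᵢ[ℝ] EuclideanSpace ℝ (Fin 3))) (c : ℝ)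
      (u V : ℝ → EuclideanSpace ℝ (Fin 3) → EuclideanSpace ℝ (Fin 3)) (C : ℝ), 1 < c →
      IsDiscretelySelfSimilar c u → (∀ g ∈ G, ∀ t x, u t (g x) = g (u t x)) →
      IsTypeIAncientMild C V → (∀ t < 0, V t =ᵐ[volume] u t) → (∀ t, 0 ≤ t → V t = 0) →
      IsDiscretelySelfSimilar c V ∧ (∀ g ∈ G, ∀ t x, V t (g x) = g (V t x)) := by
  intro G c u V C hc hdss hequ hV hae hV0
  have hc0 : 0 < c := one_pos.trans hc
  have hc2 : 0 < c ^ 2 := by positivity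
  refine ⟨?_, ?_⟩
  · -- exact discrete self-similarity of `V`
    show nsRescale c V = V
    funext t x
    rw [nsRescale_apply]
    rcases lt_or_ge t 0 with ht | ht
    · have hct : c ^ 2 * t < 0 := mul_neg_of_pos_of_neg hc2 ht
      have h1 : (fun x => c • V (c ^ 2 * t) (c • x)) =ᵐ[volume] V t := by
        have h2 : ∀ᵐ x ∂(volume : Measure (EuclideanSpace ℝ (Fin 3))),
            V (c ^ 2 * t) (c • x) = u (c ^ 2 * t) (c • x) :=
          (Measure.quasiMeasurePreserving_smul volume hc0.ne').ae (hae _ hct)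
        filter_upwards [h2, hae t ht] with x hx hx'
        have key := congrFun (congrFun hdss t) x
        rw [nsRescale_apply] at key
        rw [hx, hx', key]
      have hcont : Continuous fun x => c • V (c ^ 2 * t) (c • x) :=
        ((hV.continuous_slice hct).comp (continuous_const_smul c)).const_smul c
      exact congrFun ((hcont.ae_eq_iff_eq volume (hV.continuous_slice ht)).1 h1) x
    · rw [hV0 t ht, hV0 (c ^ 2 * t) (mul_nonneg hc2.le ht)]
      simp
  · -- `G`-equivariance of `V`
    intro g hg t x
    rcases lt_or_ge t 0 with ht | ht
    · have h1 : (fun x => V t (g x)) =ᵐ[volume] fun x => g (V t x) := by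
        have h2 : ∀ᵐ x ∂(volume : Measure (EuclideanSpace ℝ (Fin 3))), V t (g x) = u t (g x) :=
          g.measurePreserving.quasiMeasurePreserving.ae (hae t ht)
        filter_upwards [h2, hae t ht] with x hx hx'
        rw [hx, hequ g hg t x, hx']
      have hcont₁ : Continuous fun x => V t (g x) := (hV.continuous_slice ht).comp g.continuous
      have hcont₂ : Continuous fun x => g (V t x) := g.continuous.comp (hV.continuous_slice ht)
      exact congrFun ((hcont₁.ae_eq_iff_eq volume hcont₂).1 h1) x
    · rw [hV0 t ht]
      simp

end Summit.NavierStokesRegularity.NavierStokesRegularity.Theorems.PolyhedralDssProfileExists.PolyhedralCell
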